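import Summits.CriticalPhenomena.Ising3D.TaylorTableCertB2Defs
import HarnessLib

/-!
# γ-box certificate data of the M-g5 (2⁻¹⁶ box, BOX 2) functional, identity leaves file 3 of 3: pieces 30–34 of 35
(cell `pub-ising3x`, seat boot-1 gen 14; gate (g2); continues `TaylorTableCertB2Defs` — generated by gen_table.py `--what identity`)

HONEST FRAMING: lottery ticket; floor = tightest certified 3D Ising CFT bounds; no exact-solution
claim without a proof. Island framing: certified exclusion region at stated derivative order and
assumptions; not a determination of the 3D Ising critical exponents beyond that.

Leaves 30–34 of the 35-leaf adaptive identity kd-certificate `CertB2.tI` (one `decide +kernel` per leaf, ≈ 28 s each;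
leaf precision 30; bound `CertB2.bI = (-1 : ℚ)`). Assembled in `TaylorTableCertB2Identity`. What this file shows: nothing by itself. [folklore]
-/

set_option linter.style.longLine false

namespace Summit.CriticalPhenomena.Ising3D
namespace CertB2
open Set Literature.MathematicalPhysics.QuantumFieldTheory.ConformalBootstrap3D Literature.Analysis.ValidatedNumerics

set_option maxHeartbeats 0 in
/-- Identity leaf check, piece 30 of 35 (kernel; sub-box Δσ × Δε ≈ [(0.518156052, 0.518157959), (1.379999161, 1.380001068)], depth 6). [folklore] -/
theorem id_piece_30 : KdCert.check (exprLeOn (.neg (identityExpr c L)) bI) [(((271663 : ℚ) / 524288), ((16979 : ℚ) / 32768)), (((723517 : ℚ) / 524288), ((361759 : ℚ) / 262144)), (((2537542718013793081 : ℚ) / 4611686018427387904), ((2537596395662222387 : ℚ) / 4611686018427387904))] (.leaf 30) = true := by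
  decide +kernel

set_option maxHeartbeats 0 in
/-- Identity leaf check, piece 31 of 35 (kernel; sub-box Δσ × Δε ≈ [(0.518154144, 0.518156052), (1.380001068, 1.380002975)], depth 6). [folklore] -/
theorem id_piece_31 : KdCert.check (exprLeOn (.neg (identityExpr c L)) bI) [(((135831 : ℚ) / 262144), ((271663 : ℚ) / 524288)), (((361759 : ℚ) / 262144), ((723519 : ℚ) / 524288)), (((2537542718013793081 : ℚ) / 4611686018427387904), ((2537596395662222387 : ℚ) / 4611686018427387904))] (.leaf 30) = true := by
  decide +kernel

set_option maxHeartbeats 0 in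
/-- Identity leaf check, piece 32 of 35 (kernel; sub-box Δσ × Δε ≈ [(0.518154144, 0.518156052), (1.380002975, 1.380004883)], depth 6). [folklore] -/
theorem id_piece_32 : KdCert.check (exprLeOn (.neg (identityExpr c L)) bI) [(((135831 : ℚ) / 262144), ((271663 : ℚ) / 524288)), (((723519 : ℚ) / 524288), ((11305 : ℚ) / 8192)), (((2537542718013793081 : ℚ) / 4611686018427387904), ((2537596395662222387 : ℚ) / 4611686018427387904))] (.leaf 30) = true := by
  decide +kernel

set_option maxHeartbeats 0 in
/-- Identity leaf check, piece 33 of 35 (kernel; sub-box Δσ × Δε ≈ [(0.518156052, 0.518157959), (1.380001068, 1.380002975)], depth 6). [folklore] -/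
theorem id_piece_33 : KdCert.check (exprLeOn (.neg (identityExpr c L)) bI) [(((271663 : ℚ) / 524288), ((16979 : ℚ) / 32768)), (((361759 : ℚ) / 262144), ((723519 : ℚ) / 524288)), (((2537542718013793081 : ℚ) / 4611686018427387904), ((2537596395662222387 : ℚ) / 4611686018427387904))] (.leaf 30) = true := by
  decide +kernel

set_option maxHeartbeats 0 in
/-- Identity leaf check, piece 34 of 35 (kernel; sub-box Δσ × Δε ≈ [(0.518156052, 0.518157959), (1.380002975, 1.380004883)], depth 6). [folklore] -/
theorem id_piece_34 : KdCert.check (exprLeOn (.neg (identityExpr c L)) bI) [(((271663 : ℚ) / 524288), ((16979 : ℚ) / 32768)), (((723519 : ℚ) / 524288), ((11305 : ℚ) / 8192)), (((2537542718013793081 : ℚ) / 4611686018427387904), ((2537596395662222387 : ℚ) / 4611686018427387904))] (.leaf 30) = true := by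
  decide +kernel

end CertB2
end Summit.CriticalPhenomena.Ising3D
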